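import Summits.Ventures.HSemireg.Pad4TowerSeedB1Odd

/-!
# Venture HSemireg — PAD-4 on 𝔅(μ₄): first STRUCTURAL LEMMAS toward the LINE 5 (iii) pencil target `SeedB1OddDiamond8G1H1`
# (gs-eng-2 g53): the X⁺ CEILING KILL and the diamond bounds it rests on

HONEST FRAMING. Lean index of the computation cell `pub-hsemireg` (S4-PUSH, H2 door PAD-4, line stmt-HodgeConjecture-18881), written by the
cell's second-code engine `gs-eng-2` (g53). Census-neutral: these are lemmas ABOUT THE TYPED STATIC PREDICATES (`XPlusClosed`, `InDiamond`) of
`Pad4TowerXresFamilies` ∕ `Pad4TowerDiamondMu4`; nothing here is an object, a σ, a seed or a census row; NOTHING HERE SAYS THAT HC ∕ HC_CM ∕ HC_AV ∕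
H2 HOLDS OR FAILS. No `sorry`, no `axiom`, no `instance`, no notation, no Literature fact.

WHAT. The machine skeleton of the pencil target (gs-eng-2 g53's third code — an orbit-CNF generated DIRECTLY from the Lean predicates — and its
iterated failed-literal «peeling» at ◇₄ ∕ ◇₆ ∕ ◇₈, note `general-structure/PENCIL-B1ODD-gs2g53.md`) shows ONE dominant conflict: the X⁺ instance at a
`P`-cell that has a CEILING UNIT letter `6I + ℓ_u` on a factor `σ` and the TOP NODE `8I` on another factor `f`, whose `8I`-lift on `σ` is present at
level `N` and one of whose `σ`-phase-variants is present at level `P`. At the top of ◇₈ all the participant-exact breakers of the X family are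
AUTOMATICALLY silent (nothing lies above `8I`; every ◇₈ letter is causally below `8I`), so the instance fires. This file PROVES that:
**`xplus_ceiling_kill`**. With `G₁`-closure the phase-variant is frequently an orbit-mate of the head (e.g. `[O|O|6I+ℓ_u|8I]` and `Δ²`), which is
where the symmetry hypothesis of the seed enters the static game at the ceiling (LEMMA C of the note). Also: `inDiamond_le_top` ∕
`effective_top_sub` (every ◇_h letter lies causally below the top node `hI`), `not_nullBelow_top` (nothing in ◇_h lies strictly null-above `hI`).

SOURCES: `Pad4TowerXresFamilies.lean` (X family, `XPlusClosed := XresXClosed (C.dual 0)`), `Pad4TowerRuleDMu4Dual.lean` (`dualCell`,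
`mem_dual_lower∕upper`), `Pad4TowerDiamondMu4.lean` (`InDiamond`, `inDiamond_bounds`), `Pad4TowerSeedB1Odd.lean` (the target (T)); cell INBOX
l.32595 (R13.71 (3) pencil target), gs-eng-2 g53 kit j309684 ∕ j309860 (◇₆ third-code UNSAT + peeling), note PENCIL-B1ODD-gs2g53.md §2. -/

namespace Summit.Ventures.HSemireg.Pad4Tower

open Finset

/-! ## §1 Diamond bounds at the top node -/

/-- in `◇_h` every letter `x` satisfies `x.1 + |Re β| + |Im β| ≤ h` with one of `Re β`, `Im β` zero — so `hI − x` is effective: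
every ◇_h letter lies causally below (or at) the top node `hI = (h, 0, 0)`. -/
theorem effective_top_sub {h : ℤ} {x : BPoint} (hx : InDiamond h x) : Effective (bsub (h, 0, 0) x) := by
  obtain ⟨α, b1, b2⟩ := x
  obtain ⟨hax, hc, -, hα⟩ := hx
  simp only [absCharge, chargeOf] at hc hα
  simp only [Effective]
  rcases hax with h0 | ⟨h1, h2⟩ | ⟨h1, h2⟩
  · simp only [Prod.mk.injEq] at h0
    obtain ⟨rfl, rfl⟩ := h0
    simp at hα hc ⊢
    constructor <;> nlinarith
  · simp only at h1 h2
    subst h2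
    simp at hα hc ⊢
    have h3 : |b1| ≤ h - α := by omega
    have h4 : 0 ≤ h - α := le_trans (abs_nonneg _) h3
    constructor
    · linarith
    · have := abs_le.mp h3
      nlinarith [sq_abs b1, abs_nonneg b1]
  · simp only at h1 h2
    subst h1
    simp at hα hc ⊢
    have h3 : |b2| ≤ h - α := by
      have : |(-b2)| = |b2| := abs_neg b2
      omega
    have h4 : 0 ≤ h - α := le_trans (abs_nonneg _) h3
    constructor
    · linarith
    · have := abs_le.mp h3
      nlinarith [sq_abs b2, abs_nonneg b2]

/-- in `◇_h` every letter has `α ≤ h`. -/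
theorem inDiamond_le_top {h : ℤ} {x : BPoint} (hx : InDiamond h x) : x.1 ≤ h :=
  (inDiamond_bounds hx).2.1

/-- nothing in `◇_h` lies strictly null-ABOVE the top node: in dual coordinates (`dualPt 0`), no dual letter is strictly null-below
`(−h, 0, 0)`. -/
theorem not_nullBelow_top {h : ℤ} {x : BPoint} (hx : InDiamond h x) : ¬ NullBelow (dualPt 0 x) (-h, 0, 0) := by
  rintro ⟨hlt, -⟩
  have := inDiamond_le_top hx
  simp at hlt
  omega

/-! ## §2 The X⁺ ceiling kill -/

/-- the ceiling unit letter `6I + ℓ_{i^u}` of ◇₈ (`(a, b) = (8, 6)` in its frame). -/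
abbrev cu8 (u : Fin 4) : BPoint := ray (6, 0, 0) u 1

/-- the top node `8I`. -/
abbrev top8 : BPoint := (8, 0, 0)

/-- **LEMMA C — THE X⁺ CEILING KILL.** In a two-level configuration inside ◇₈ that is `X⁺`-closed, let the `P`-cell `Z` carry the ceiling unit
letter `6I + ℓ_u` on the factor `σ` and the top node `8I` on a factor `f ≠ σ`. If the `8I`-lift `Z(σ ↦ 8I)` is present at level `N` and a
`σ`-phase-variant `Z(σ ↦ 6I + ℓ_v)`, `v ≠ u`, is present at level `P`, we have a contradiction: the X⁺ instance (head `Z`, partner = the lift —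
the LOWEST `N`-cell above `Z_σ`, reached by the antipodal step —, sibling = the variant one step below the lift in direction `v + 2 ≠ u + 2`,
demand factor `f`) fires, because at the top of ◇₈ the (H-e′)∕(H-b)∕`W_f = ∅` breakers of the X family are automatically silent (every ◇₈ letter is
causally below `8I`, none is strictly null-above it) and no companion fits strictly between heights 7 and 8. [unfolding `XPlusClosed`] -/
theorem xplus_ceiling_kill {C : MConfig} (hU : C.InDiamond 8) (hX : XPlusClosed C) {Z : MCell} (hZ : Z ∈ C.upper)
    {σ f : Fin 4} (hfσ : f ≠ σ) {u v : Fin 4} (hvu : v ≠ u) (hZσ : Z σ = cu8 u) (hZf : Z f = top8)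
    (hq : Function.update Z σ top8 ∈ C.lower) (hn : Function.update Z σ (cu8 v) ∈ C.upper) : False := by
  -- the dual cells
  set Z' : MCell := dualCell 0 Z with hZ'
  set q' : MCell := dualCell 0 (Function.update Z σ top8) with hq'
  set n' : MCell := dualCell 0 (Function.update Z σ (cu8 v)) with hn'
  have hZ'mem : Z' ∈ (C.dual 0).lower := dualCell_mem_dual_lower hZ
  have hq'mem : q' ∈ (C.dual 0).upper := dualCell_mem_dual_upper hq
  have hn'mem : n' ∈ (C.dual 0).lower := dualCell_mem_dual_lower hn
  -- letters at σ and f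
  have eZσ : Z' σ = dualPt 0 (cu8 u) := by simp [hZ', dualCell, hZσ]
  have eZf : Z' f = (-8, 0, 0) := by simp [hZ', dualCell, hZf, top8, dualPt]
  have eqσ : q' σ = (-8, 0, 0) := by simp [hq', dualCell, top8, dualPt]
  have enσ : n' σ = dualPt 0 (cu8 v) := by simp [hn', dualCell]
  have eqg : ∀ g, g ≠ σ → q' g = Z' g := fun g hg => by simp [hq', hZ', dualCell, Function.update_of_ne hg]
  have eng : ∀ g, g ≠ σ → n' g = q' g := fun g hg => by simp [hn', hq', dualCell, Function.update_of_ne hg]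
  -- every dual letter of an N-cell of C is causally above (−8,0,0), has α ≥ −8, and is not strictly null-below (−8,0,0)
  have key : ∀ x : BPoint, InDiamond 8 x →
      Effective (bsub (dualPt 0 x) (-8, 0, 0)) ∧ -8 ≤ (dualPt 0 x).1 ∧ ¬ NullBelow (dualPt 0 x) (-8, 0, 0) := by
    intro x hx
    refine ⟨?_, ?_, not_nullBelow_top hx⟩
    · have e : bsub (dualPt 0 x) (-8, 0, 0) = bsub (8, 0, 0) x := by
        obtain ⟨a, b, c⟩ := x
        simp only [bsub, Prod.mk.injEq]
        refine ⟨by ring, by ring, by ring⟩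
      rw [e]; exact effective_top_sub hx
    · have := inDiamond_le_top hx
      obtain ⟨a, b, c⟩ := x
      simp only at this ⊢
      omega
  have bound : ∀ P ∈ (C.dual 0).upper, ∀ g,
      Effective (bsub (P g) (-8, 0, 0)) ∧ -8 ≤ (P g).1 ∧ ¬ NullBelow (P g) (-8, 0, 0) := by
    intro P hP g
    have hN : dualCell 0 P ∈ C.lower := mem_dual_upper.mp hP
    have hx : InDiamond 8 (dualCell 0 P g) := hU.1 _ hN g
    have e1 : P g = dualPt 0 (dualCell 0 P g) := by simp [dualCell, dualPt_dualPt]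
    rw [e1]; exact key _ hx
  apply hX Z' hZ'mem q' hq'mem n' hn'mem σ (u + 2) (v + 2) f
  refine ⟨?_, hfσ, ⟨?_, ?_, ?_⟩, ?_, ?_, ⟨?_, ?_, ?_⟩, ?_, ?_, ?_, ?_⟩
  · -- head letter charged
    rw [eZσ]; fin_cases u <;> simp [isApex]
  · -- partner agrees off σ
    exact fun g hg => eqg g hg
  · rw [eqσ, eZσ]; fin_cases u <;> simp
  · rw [eqσ, eZσ]; fin_cases u <;> simp [ray, dualPt]
  · -- topmost: any dual u+2-partner above q' has α ≤ −8
    intro P hP hPZ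
    obtain ⟨-, hlt, -⟩ := hPZ
    have hb := (bound P hP σ).2.1
    rw [eqσ]; rw [eZσ] at hlt
    revert hlt hb
    fin_cases u <;> simp <;> intro h1 h2 <;> omega
  · -- w ≠ u'
    revert hvu; fin_cases u <;> fin_cases v <;> decide
  · -- sibling agrees off σ
    exact fun g hg => eng g hg
  · rw [eqσ, enσ]; fin_cases v <;> simp
  · rw [eqσ, enσ]; fin_cases v <;> simp [ray, dualPt]
  · -- no companion strictly between heights −8 and −7
    intro P hP _ h1 h2
    rw [eqσ] at h1; rw [enσ] at h2
    revert h1 h2; fin_cases v <;> simp [ray] <;> intro h1 h2 <;> omega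
  · -- (H-e') dual: everything is causally below 8I
    intro P hP _ _ _ _
    rw [eqσ]; exact (bound P hP σ).1
  · -- (H-b) dual: nothing strictly null-above 8I on f
    intro P hP _ hnb _
    rw [eZf] at hnb
    exact absurd hnb (bound P hP f).2.2
  · -- W_f = ∅ dual
    intro P hP hnb
    rw [eZf] at hnb
    exact absurd hnb (bound P hP f).2.2

/-! ## §3 RULE D at the ceiling and at the floor: forced lifts and cancellations (LEMMA U of the note) -/

/-- a ◇_h letter at the top height IS the top node. -/
theorem eq_top_of_inDiamond {h : ℤ} {x : BPoint} (hx : InDiamond h x) (h1 : x.1 = h) : x = (h, 0, 0) := by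
  obtain ⟨α, b1, b2⟩ := x
  obtain ⟨hax, hc, -, hα⟩ := hx
  simp only [absCharge, chargeOf] at hc hα
  simp only at h1
  subst h1
  rcases hax with h0 | ⟨h1, h2⟩ | ⟨h1, h2⟩
  · simp only [Prod.mk.injEq] at h0; obtain ⟨rfl, rfl⟩ := h0; rfl
  · simp only at h1 h2; subst h2; simp at hα; exact absurd hα h1
  · simp only at h1 h2; subst h1; simp at hα; exact absurd hα h2

/-- a ◇_h letter has `α ≥ 0`, and at height `0` it IS the apex `O`. -/
theorem inDiamond_nonneg {h : ℤ} {x : BPoint} (hx : InDiamond h x) : 0 ≤ x.1 := (inDiamond_bounds hx).1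

/-- a ◇_h letter at height `0` is the apex `O`. -/
theorem eq_O_of_inDiamond {h : ℤ} {x : BPoint} (hx : InDiamond h x) (h0 : x.1 = 0) : x = (0, 0, 0) := by
  obtain ⟨α, b1, b2⟩ := x
  obtain ⟨hax, hc, -, -⟩ := hx
  simp only [absCharge, chargeOf] at hc
  simp only at h0
  subst h0
  rcases hax with h0 | ⟨h1, h2⟩ | ⟨h1, h2⟩
  · simp only [Prod.mk.injEq] at h0; obtain ⟨rfl, rfl⟩ := h0; rfl
  · simp only at h1 h2; subst h2; simp at hc; exact absurd hc h1
  · simp only at h1 h2; subst h1; simp at hc; exact absurd hc h2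

/-- **LEMMA L (the 8I-lift is forced).** In ◇₈, a `P`-cell `Z` passing RULE D that carries the ceiling unit letter `6I + ℓ_u` on `σ` and the top
node `8I` on `f ≠ σ` has its lift `Z(σ ↦ 8I)` present at level `N`: the coordinate pair (antipodal coordinate `6` on `σ`, any coordinate `8` of
the apex `8I` on `f`) is unequal; nothing lies above `8I`, so neither service above on `f` nor a cover exists, and the only letter of ◇₈ above
`6I + ℓ_u` is `8I` (direction `u + 2`). [unfolding `RuleDMu4P`] -/
theorem lift_of_ceiling_unit {C : MConfig} (hU : C.InDiamond 8) {Z : MCell} (hD : RuleDMu4P C Z)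
    {σ f : Fin 4} (hfσ : f ≠ σ) {u : Fin 4} (hZσ : Z σ = cu8 u) (hZf : Z f = top8) :
    Function.update Z σ top8 ∈ C.lower := by
  have had1 : Adapted (Z σ) (u + 2) := by rw [hZσ]; fin_cases u <;> simp [Adapted]
  have had2 : Adapted (Z f) 0 := by rw [hZf]; simp [Adapted]
  have hne : coord (Z σ) (u + 2) ≠ coord (Z f) 0 := by
    rw [hZσ, hZf]; fin_cases u <;> simp [coord]
  -- nothing of C.lower lies above 8I on f
  have noabove : ∀ N ∈ C.lower, ¬ (Z f).1 < (N f).1 := fun N hN hlt => by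
    have := inDiamond_le_top (hU.1 N hN f); rw [hZf] at hlt; simp at hlt; omega
  rcases hD σ f (Ne.symm hfσ) (u + 2) 0 had1 had2 hne with ⟨r, hr, N, hN, hag, hlt, hray⟩ | ⟨r, -, N, hN, -, hlt, -⟩ |
      ⟨a, b, -, -, N, hN, -, -, -, hlt, -⟩
  · -- served above on σ: the server letter is a ◇₈ letter above height 7, hence 8I
    have h8 : N σ = top8 := by
      have hle := inDiamond_le_top (hU.1 N hN σ)
      rw [hZσ] at hlt
      have : (N σ).1 = 8 := by revert hlt hle; fin_cases u <;> simp <;> intro h1 h2 <;> omega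
      exact eq_top_of_inDiamond (hU.1 N hN σ) this
    have hNe : N = Function.update Z σ top8 := by
      funext g
      by_cases hg : g = σ
      · subst hg; simp [h8]
      · rw [Function.update_of_ne hg]; exact (hag g hg).symm
    rw [← hNe]; exact hN
  · exact absurd hlt (noabove N hN)
  · exact absurd hlt (noabove N hN)

/-- the floor unit letter `ℓ_{i^u}` (`(a, b) = (2, 0)`). -/
abbrev fu (u : Fin 4) : BPoint := ray (0, 0, 0) u 1

/-- **LEMMA U (cancellations are forced).** In ◇₈, an `N`-cell passing RULE D all of whose letters are floor unit letters `ℓ_{u_f}` (a fully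
charged floor unit cell, any phases) has all four cancellations `Z(g ↦ O)` present at level `P`: against any other factor `j` the pair (own
coordinate `2` on `g`, antipodal coordinate `0` on `j`) is unequal; below a floor letter the only ◇₈ letter is `O`, in the letter's own
direction, so neither the antipodal-side service on `j` nor a cover (which would need direction `u_j + 2` on `j`) exists. [unfolding `RuleDMu4N`] -/
theorem cancellation_of_floor_unit {C : MConfig} (hU : C.InDiamond 8) {Z : MCell} (hD : RuleDMu4N C Z)
    (us : Fin 4 → Fin 4) (hZ : ∀ f, Z f = fu (us f)) (g : Fin 4) : Function.update Z g (0, 0, 0) ∈ C.upper := by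
  -- another factor
  obtain ⟨j, hj⟩ : ∃ j : Fin 4, j ≠ g := ⟨g + 1, by fin_cases g <;> decide⟩
  have had1 : Adapted (Z g) (us g) := by rw [hZ g]; generalize us g = u; fin_cases u <;> simp [Adapted]
  have had2 : Adapted (Z j) (us j + 2) := by rw [hZ j]; generalize us j = u; fin_cases u <;> simp [Adapted]
  have hne : coord (Z g) (us g) ≠ coord (Z j) (us j + 2) := by
    rw [hZ g, hZ j]; generalize us g = u; generalize us j = w; fin_cases u <;> fin_cases w <;> simp [coord]
  -- below a floor unit letter: only O, reached in the letter's own direction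
  have below : ∀ P ∈ C.upper, ∀ f r, (P f).1 < (Z f).1 → Z f = ray (P f) r ((Z f).1 - (P f).1) → P f = (0, 0, 0) ∧ r = us f := by
    intro P hP f r hlt hray
    have h0 := inDiamond_nonneg (hU.2 P hP f)
    rw [hZ f] at hlt
    have hPf : (P f).1 = 0 := by revert hlt h0; generalize us f = u; fin_cases u <;> simp <;> intro h1 h2 <;> omega
    have hO := eq_O_of_inDiamond (hU.2 P hP f) hPf
    refine ⟨hO, ?_⟩
    rw [hO, hZ f] at hray
    revert hray; generalize us f = u; fin_cases u <;> fin_cases r <;> simp [ray]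
  rcases hD g j (Ne.symm hj) (us g) (us j + 2) had1 had2 hne with ⟨r, -, P, hP, hag, hlt, hray⟩ | ⟨r, hr, P, hP, -, hlt, hray⟩ |
      ⟨a, b, -, hb, P, hP, -, -, -, hlt, hray⟩
  · obtain ⟨hO, -⟩ := below P hP g r hlt hray
    have hPe : P = Function.update Z g (0, 0, 0) := by
      funext f
      by_cases hf : f = g
      · subst hf; simp [hO]
      · rw [Function.update_of_ne hf]; exact hag f hf
    rw [← hPe]; exact hP
  · obtain ⟨-, rfl⟩ := below P hP j r hlt hray
    have h4 : ∀ u : Fin 4, u = u + 2 + 2 := by decide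
    exact absurd (h4 _) hr
  · obtain ⟨-, rfl⟩ := below P hP j b hlt hray
    rcases hb with hb | ⟨hap, -⟩
    · exact absurd hb.symm (by generalize us j = u; fin_cases u <;> decide)
    · rw [hZ j] at hap; revert hap; generalize us j = u; fin_cases u <;> simp [isApex]

/-! ## §4 First peeled cells: RULE D + `G₁` + X⁺ together (the pattern of the machine's round 1) -/

/-- **COROLLARY (the `[x|y|6I+ℓ_u|8I]` cells with `Δ²`-fixed `x, y` are absent).** On a `G₁`-closed `H₁`-static two-level support inside
◇₈, no `P`-cell `[x | y | 6I + ℓ_u | 8I]` with APEX letters `x, y` (nodes, `β = 0`) is present: RULE D forces its `8I`-lift (LEMMA L), `Δ²`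
(two applications of `DeltaClosed`) supplies the phase-variant `[x | y | 6I + ℓ_{u+2} | 8I]` at level `P`, and the X⁺ ceiling kill fires
(LEMMA C). The symmetry hypothesis of the seed is used exactly once (the `Δ²`-mate). -/
theorem not_mem_apex_apex_cu_top {C : MConfig} (hU : C.InDiamond 8) (hG : C.G1Closed) (hS : C.StaticH1)
    {x y : BPoint} (hx : isApex x) (hy : isApex y) (u : Fin 4) : mcellOf x y (cu8 u) top8 ∉ C.upper := by
  intro hZ
  set Z : MCell := mcellOf x y (cu8 u) top8 with hZdef
  have hZ2 : Z 2 = cu8 u := by simp [hZdef, mcellOf]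
  have hZ3 : Z 3 = top8 := by simp [hZdef, mcellOf]
  have hq : Function.update Z 2 top8 ∈ C.lower := lift_of_ceiling_unit hU (hS.1.2 Z hZ) (by decide) hZ2 hZ3
  -- the Δ²-mate is the phase-variant at σ = 2
  have hn0 : Z.delta.delta ∈ C.upper := hG.2.2.2 _ (hG.2.2.2 _ hZ)
  have hdd : ∀ z : BPoint, isApex z → deltaPt (deltaPt z) = z := by
    rintro ⟨a, b, c⟩ ⟨hb, hc⟩; simp only at hb hc; subst hb; subst hc; simp [deltaPt]
  have hn : Z.delta.delta = Function.update Z 2 (cu8 (u + 2)) := by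
    funext g
    fin_cases g
    · simp [MCell.delta, hZdef, mcellOf, hdd x hx]
    · simp [MCell.delta, hZdef, mcellOf, hdd y hy]
    · simp [MCell.delta, hZdef, mcellOf]; fin_cases u <;> simp [deltaPt]
    · simp [MCell.delta, hZdef, mcellOf, top8, deltaPt]
  rw [hn] at hn0
  exact xplus_ceiling_kill hU hS.2.1 hZ (σ := 2) (f := 3) (by decide) (v := u + 2) (by fin_cases u <;> decide) hZ2 hZ3 hq hn0

end Summit.Ventures.HSemireg.Pad4Tower
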